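import Mathlib
import Summits.ResolutionOfSingularities.ResolutionOfSingularities.Theorems.WildQuotientsWildQuotientResolutionCyclicTransfer
import Summits.ResolutionOfSingularities.ResolutionOfSingularities.Theorems.WildQuotientsWildQuotientResolutionAffineQuotientData
import Summits.ResolutionOfSingularities.ResolutionOfSingularities.Theorems.WildQuotientsWildQuotientResolutionAffineQuotientEtale
import Summits.ResolutionOfSingularities.ResolutionOfSingularities.Theorems.WildQuotientsWildQuotientResolutionTwoBlocksCentreStable
import Summits.ResolutionOfSingularities.ResolutionOfSingularities.Theorems.WildQuotientsWildQuotientResolutionLinearSmallBlocksAlgebra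
import Summits.ResolutionOfSingularities.ResolutionOfSingularities.Theorems.WildQuotientsWildQuotientResolutionFixedPointsGraded
import Literature.AlgebraicGeometry.Resolution.ProjectiveSpaceRegular
import HarnessLib

/-!
# Rung LSB: `𝔸ⁿ/⟨σ⟩` has a resolution GIVEN a terminal model, for every coordinate action with blocks of size ≤ 2

(crux stmt-ResolutionOfSingularities-15640 `WildQuotients.WildQuotientResolution`, line `Sketch`;
rung LSB of `L/w45c/CHAIN.md` v3, candidate (4) `linearSmallBlocks_hasResolution_of_model` of
`W45cPlanSignaturesV3.lean` with the planning abbreviations `SpecActionLaw`/`IsTerminalModel`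
unfolded; [OURS · L1 W4.5c] — NOT a statement of any manuscript.)

For a coordinate `ℤ/p`-action `σ` on `𝔸ⁿ_k` with Jordan blocks of size `≤ 2` (`σ xᵢ = xᵢ + x_{f i}`
on `D ≠ ∅`, identity off `D`, `f(D) ∩ D = ∅`; any prime `p`, any `n`):
* `idealSheaf_centre_comap` — the ideal sheaf of the centre `(x_{f i} : i ∈ D)` is stable under
  every action `ρ g = Spec (g⁻¹)` of `⟨σ⟩` (hypothesis of `IsBlowup.liftAction`);
* `linearSmallBlocks_hasResolution_of_model` — `Spec k[x]^σ` has a resolution AS SOON AS the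
  action admits a Király–Lütkebohmert terminal model (`hmodel`): affine quotient data
  (`…AffineQuotientData`), generic étaleness over `D(x_{f i₀})` (`…AffineQuotientEtale`,
  `LinearSmallBlocks.X_mem_augIdeal_of_transvection`), `|⟨σ⟩| = p`
  (`LinearSmallBlocks.card_zpowers`), `dim = n > 0`, fed to
  `CyclicTransfer.cyclicDivisorialTransfer_of_card`.
Instances: programme T (`n = 4`), `𝔸^{2m}/(J₂^{⊕m})` (non-Cohen–Macaulay for `m ≥ 3`), all linear
`ℤ/2`-quotients in characteristic `2`.
-/

-- single-problem summit: the doubled namespace component `ResolutionOfSingularities` is forced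
set_option linter.dupNamespace false

noncomputable section

open CategoryTheory AlgebraicGeometry TopologicalSpace MvPolynomial
open scoped Pointwise
open Literature.AlgebraicGeometry.Resolution

namespace Summit.ResolutionOfSingularities.ResolutionOfSingularities.Theorems.WildQuotientResolution.LinearSmallBlocks

/-- **The ideal sheaf of the centre `(x_{f i} : i ∈ D)` on `𝔸ⁿ` is stable under the action of
`⟨σ⟩`** (`ρ g = Spec (g⁻¹)`) — the hypothesis `hρ` of `IsBlowup.liftAction`. [folklore] -/
theorem idealSheaf_centre_comap (k : Type) [Field k] (n : ℕ)
    (σ : MvPolynomial (Fin n) k ≃ₐ[k] MvPolynomial (Fin n) k)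
    (D : Finset (Fin n)) (f : Fin n → Fin n) (hfD : ∀ i ∈ D, f i ∉ D)
    (hσ : ∀ i ∉ D, σ (X i) = X i)
    (ρ : ↥(Subgroup.zpowers σ) →* Aut (Spec (CommRingCat.of (MvPolynomial (Fin n) k))))
    (hρ : ∀ g : ↥(Subgroup.zpowers σ), (ρ g).hom = Spec.map (CommRingCat.ofHom
      ((MulSemiringAction.toRingEquiv (↥(Subgroup.zpowers σ)) (MvPolynomial (Fin n) k) g⁻¹ :
        MvPolynomial (Fin n) k ≃+* MvPolynomial (Fin n) k) :
          MvPolynomial (Fin n) k →+* MvPolynomial (Fin n) k)))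
    (g : ↥(Subgroup.zpowers σ)) :
    (affineBlowup.idealSheaf (Ideal.span (X '' (f '' (↑D : Set (Fin n))) :
        Set (MvPolynomial (Fin n) k)))).comap (ρ g).hom =
      affineBlowup.idealSheaf (Ideal.span (X '' (f '' (↑D : Set (Fin n))))) :=
  AffineQuotient.idealSheaf_comap_specAction ρ hρ _ (smul_centre_eq k n σ D f hfD hσ) g

/-- **Rung LSB modulo its terminal model** (V3 (4)): for a coordinate `ℤ/p`-action with Jordan
blocks of size `≤ 2` and `D ≠ ∅`, and EVERY action `ρ : ⟨σ⟩ →* Aut 𝔸ⁿ` with `ρ g = Spec (g⁻¹)`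
admitting a Király–Lütkebohmert terminal model (`hmodel`: the seven model-side hypotheses of
`CyclicTransfer.cyclicDivisorialTransfer_of_card`), the quotient `Spec k[x]^σ` has a resolution of
singularities. [cite: KiralyLutkebohmert2013, Thm 2] [cite: SGA1, Exp. V, §1–2] -/
theorem linearSmallBlocks_hasResolution_of_model (p : ℕ) (hp : p.Prime) (k : Type) [Field k]
    [CharP k p] (n : ℕ) (σ : MvPolynomial (Fin n) k ≃ₐ[k] MvPolynomial (Fin n) k)
    (D : Finset (Fin n)) (f : Fin n → Fin n) (hfD : ∀ i ∈ D, f i ∉ D) (hD : D.Nonempty)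
    (hσD : ∀ i ∈ D, σ (X i) = X i + X (f i)) (hσ : ∀ i ∉ D, σ (X i) = X i)
    (hmodel : ∀ ρ : ↥(Subgroup.zpowers σ) →* Aut (Spec (CommRingCat.of (MvPolynomial (Fin n) k))),
      (∀ g : ↥(Subgroup.zpowers σ), (ρ g).hom = Spec.map (CommRingCat.ofHom
        ((MulSemiringAction.toRingEquiv (↥(Subgroup.zpowers σ)) (MvPolynomial (Fin n) k) g⁻¹ :
          MvPolynomial (Fin n) k ≃+* MvPolynomial (Fin n) k) :
            MvPolynomial (Fin n) k →+* MvPolynomial (Fin n) k))) →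
      ∃ (V : Scheme.{0}) (π : V ⟶ Spec (CommRingCat.of (MvPolynomial (Fin n) k)))
        (ρV : ↥(Subgroup.zpowers σ) →* Aut V), IsProper π ∧ IsBirational π ∧
        IsIntegral V ∧ Scheme.IsRegular V ∧
        (∀ g : ↥(Subgroup.zpowers σ), (ρV g).hom ≫ π = π ≫ (ρ g).hom) ∧
        (∀ v : V, ∃ W : V.Opens, IsAffineOpen W ∧ v ∈ W ∧
          ∀ g : ↥(Subgroup.zpowers σ), (ρV g).hom ⁻¹ᵁ W = W) ∧
        (∀ (g : ↥(Subgroup.zpowers σ)) (v : V) (hv : (ρV g).hom.base v = v),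
          (Ideal.span (Set.range fun s : V.presheaf.stalk v =>
            (V.presheaf.stalkSpecializes (specializes_of_eq hv) ≫ (ρV g).hom.stalkMap v).hom s -
              s)).IsPrincipal)) :
    Scheme.HasResolution
      (Spec (.of (FixedPoints.subalgebra k (MvPolynomial (Fin n) k) (Subgroup.zpowers σ)))) := by
  classical
  haveI : Fact p.Prime := ⟨hp⟩
  have hσp : σ ^ p = 1 := pow_prime_eq_one k n σ D f hfD hσD hσ p
  have hcard : Nat.card (Subgroup.zpowers σ) = p := card_zpowers k n σ D f hfD hσD hσ p hp hD
  obtain ⟨i₀, hi₀⟩ := hD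
  have hn : 0 < n := Fin.pos i₀
  -- the rings: `S = k[x]`, `G = ⟨σ⟩`, `A = S^G`
  let S : Type := MvPolynomial (Fin n) k
  let G : Type := ↥(Subgroup.zpowers σ)
  haveI : Finite G := Nat.finite_of_card_ne_zero (hcard ▸ hp.ne_zero)
  let A : Subalgebra k S := FixedPoints.subalgebra k S G
  -- the action on `𝔸ⁿ` and its terminal model
  obtain ⟨ρ, hρ⟩ := AffineQuotient.exists_specAction S G
  obtain ⟨V, π, ρV, hVprop, hbir, hVint, hVreg, hequiv, hcov, hdiv⟩ := hmodel ρ hρ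
  haveI := hVprop
  haveI := hVint
  -- the quotient data
  let fk : Spec (.of A) ⟶ Spec (.of k) := Spec.map (CommRingCat.ofHom (algebraMap k A))
  let q : Spec (.of S) ⟶ Spec (.of A) := Spec.map (CommRingCat.ofHom (algebraMap A S))
  haveI : LocallyOfFiniteType fk := AffineQuotient.locallyOfFiniteType_specMap_fixedPoints k
  haveI : IsFinite q := AffineQuotient.isFinite_specMap_fixedPoints k
  have hsurj : Function.Surjective q.base := AffineQuotient.surjective_specMap_fixedPoints k
  have hρq : ∀ g : G, (ρ g).hom ≫ q = q := AffineQuotient.specAction_comp k ρ hρ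
  have horb : ∀ x y : Spec (CommRingCat.of S), q.base x = q.base y →
      ∃ g : G, (ρ g).hom.base x = y :=
    fun x y hxy => AffineQuotient.exists_specAction_base_eq k ρ hρ x y hxy
  -- generically étale: over `D(x_{f i₀})`
  have hX0 : (X (f i₀) : S) ∈ A :=
    (TameTransfer.mem_fixedPoints_zpowers_iff_apply_eq σ (X (f i₀))).mpr (hσ (f i₀) (hfD i₀ hi₀))
  have ht0 : (⟨X (f i₀), hX0⟩ : A) ≠ 0 := fun h =>
    MvPolynomial.X_ne_zero (f i₀) (congrArg Subtype.val h : ((⟨X (f i₀), hX0⟩ : A) : S) = ((0 : A) : S))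
  have hU : ∃ U : (Spec (.of A)).Opens, Dense (U : Set (Spec (.of A))) ∧ Etale (q ∣_ U) :=
    AffineQuotient.exists_dense_etale_morphismRestrict k (⟨X (f i₀), hX0⟩ : A) ht0
      fun g hg => X_mem_augIdeal_of_transvection k p hp σ (f i₀) i₀ (hσ (f i₀) (hfD i₀ hi₀))
        (hσD i₀ hi₀) hσp g hg
  -- `dim X₁ = dim 𝔸ⁿ = n > 0`
  have hdim : ¬ topologicalKrullDim (Spec (CommRingCat.of A)) ≤ 0 := by
    rw [AffineQuotient.topologicalKrullDim_spec_fixedPoints k,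
      AffineQuotient.topologicalKrullDim_spec_mvPolynomial k n]
    have hn' : (0 : WithBot ℕ∞) < (n : WithBot ℕ∞) := by exact_mod_cast hn
    exact not_le.mpr hn'
  -- the transfer
  exact CyclicTransfer.cyclicDivisorialTransfer_of_card p hp k (Spec (.of S)) (Spec (.of A)) fk q G ρ
    hcard hdim hsurj hU hρq horb V π ρV hbir hVreg hequiv hcov hdiv

end Summit.ResolutionOfSingularities.ResolutionOfSingularities.Theorems.WildQuotientResolution.LinearSmallBlocks

end
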